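import Summits.CriticalPhenomena.PercolationContinuityZ3.Theorems.PercNearOneGluingNoHeavyRsw3WMSFNoBranching
import HarnessLib

/-!
# RSW3 lane (P2, gen 30): THE WIRED MINIMAL SPANNING FOREST, VIII — **THE WMSF-EXPECTED DEGREE OF EVERY VERTEX OF `ℤ^d` IS `2`** (Lyons–Peres 2016 Thm. 11.11,
# first assertion, on `ℤ^d`), by the parent transport

builds on p205010 (kernel theorem, internal audit signed; external expert review pending) — used through gen 29's a.s. backbones.

Cell `prim-rsw3`, prover seat `prim-rsw3-p2` (gen 30), memo `run/shared/lean/prim/rsw3/P2-RSWLITE.md` §37.  Support file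
(`--supports stmt-CriticalPhenomena-4575`); no definitions, no named facts, no sorries.  In the canonical orientation of `𝔉_w(ℤ^d)` (file I) the forest neighbours of `o` are its
parent `R_o(1)` and its children `{w : R_w(1) = o}`; the transport `f(w, v; U) = 1[U injective ∧ ξ(w, v; T_U(w))]` ("`v` is the parent of `w`", files III–IV) sends mass exactly `1`
from every vertex, so by the mass-transport principle the expected number of children is `1` and the expected degree is `2`.

* §1 `encard_forestNeighbours_eq` (deterministic, good label field): `deg_{𝔉_w}(o) = 1 + #{w : ξ(w, o; T(w))}` as extended naturals;
  `configDegree_wmsf_eq` (the Barriers library's `configDegree`).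
* §2 **`lintegral_encard_children_eq_one`** (`E #children = 1`) and **`lintegral_configDegree_wmsf_eq_two`** (`E deg_{𝔉_w(ℤ^d)}(o) = 2`, `d ≥ 2`); `ℤ³` instance.

References: R. Lyons, Y. Peres, *Probability on Trees and Networks* (2016), Thm. 11.11 ("the WMSF-expected degree of each vertex is 2"), §8.1 [LyonsPeres2016]; R. Lyons,
Y. Peres, O. Schramm, Ann. Probab. 34 (2006) §3 [LyonsPeresSchramm2006].
-/

noncomputable section

namespace Summit.CriticalPhenomena.PercolationContinuityZ3.Theorems.Rsw3

open Finset Filter MeasureTheory Literature.Probability.LatticeModels Literature.Probability.Percolation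
open Literature.Probability.Percolation.Invasion Literature.Barriers.CriticalPhenomena
open scoped ENNReal

section General

variable {V : Type*} [DecidableEq V] {G : SimpleGraph V} [G.LocallyFinite]

/-- **The forest neighbours of `o` are its parent and its children**: on a good label field, `{y : [o, y] ∈ 𝔉_w, y ≠ o} = {R_o(1)} ∪ {w : ξ(w, o; T(w))}`, a disjoint union; hence
`#{y : 𝔉_w-neighbour of o} = 1 + #{w : ξ(w, o; T(w))}`. [cite: LyonsPeres2016, Thm. 11.11–11.12 (orientation toward the special end)] -/
theorem encard_forestNeighbours_eq [Infinite V] (hG : G.Preconnected) {U : Sym2 V → ℝ} (hU : Function.Injective U)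
    (hout : ∀ v : V, ∀ k, ∃ m, k ≤ m ∧ IsOutlet G U v m)
    (hray : ∀ v : V, ∃! R : ℕ → V, Function.Injective R ∧ R 0 = v ∧ ∀ i, (tree G U v).Adj (R i) (R (i + 1))) (o : V) :
    {y | (openGraph (wmsf G U)).Adj o y}.encard = 1 + {w | InfBranch (treeEdges G U w) w o}.encard := by
  classical
  have hex : ∀ v : V, ∃ R : ℕ → V, Function.Injective R ∧ R 0 = v ∧ ∀ i, (tree G U v).Adj (R i) (R (i + 1)) := fun v => (hray v).exists
  choose R hR hR0 hRadj using hex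
  have hex' : ∀ v : V, ∃ R : ℕ → V, Function.Injective R ∧ R 0 = v ∧ ∀ i, (tree G U v).Adj (R i) (R (i + 1)) := fun v => (hray v).exists
  have hUi : Set.InjOn U G.edgeSet := hU.injOn
  have hpar : ∀ z y, InfBranch (treeEdges G U z) z y ↔ y = R z 1 :=
    fun z y => infBranch_treeEdges_iff_eq_ray_one hG (hout z) (hR z) (hR0 z) (hRadj z) y
  -- neighbours = {parent} ∪ children, disjointly
  have hset : {y | (openGraph (wmsf G U)).Adj o y} = insert (R o 1) {w | InfBranch (treeEdges G U w) w o} := by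
    ext y
    simp only [Set.mem_setOf_eq, Set.mem_insert_iff]
    constructor
    · intro hy
      rw [openGraph_adj] at hy
      rcases parent_or_parent hG hU hout hy.1 (hR o) (hR0 o) (hRadj o) (hR y) (hR0 y) (hRadj y) with h | h
      · exact Or.inl h.symm
      · exact Or.inr ((hpar y o).2 h.symm)
    · rintro (rfl | hy)
      · have h := tree_le_fromEdgeSet_wmsf hUi o (hRadj o 0)
        rw [hR0] at h
        exact h
      · obtain h := (hpar y o).1 hy
        have h' := tree_le_fromEdgeSet_wmsf hUi y (hRadj y 0)
        rw [hR0, ← h] at h'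
        exact h'.symm
  have hnot : R o 1 ∉ {w | InfBranch (treeEdges G U w) w o} := by
    intro h
    have h1 : o = R (R o 1) 1 := (hpar _ _).1 h
    exact not_parent_and_parent hG hU hout hex' (hR o) (hR0 o) (hRadj o) (hR (R o 1)) (hR0 _) (hRadj _) ⟨rfl, h1.symm⟩
  rw [hset, Set.encard_insert_of_notMem hnot, add_comm]

/-- The Barriers library's `configDegree G (𝔉_w U) o` is the number of forest neighbours of `o`. [folklore] -/
theorem configDegree_wmsf_eq (U : Sym2 V → ℝ) (o : V) :
    (configDegree G (wmsf G U) o : ℕ∞) = {y | (openGraph (wmsf G U)).Adj o y}.encard := by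
  classical
  rw [configDegree]
  have : {y | (openGraph (wmsf G U)).Adj o y} = ↑((G.neighborFinset o).filter fun y => s(o, y) ∈ wmsf G U) := by
    ext y
    simp only [Set.mem_setOf_eq, coe_filter, SimpleGraph.mem_neighborFinset, openGraph_adj]
    constructor
    · rintro ⟨hmem, hne⟩
      exact ⟨(SimpleGraph.mem_edgeSet G).1 (mem_edgeSet_of_mem_wmsf G hmem), hmem⟩
    · rintro ⟨hadj, hmem⟩
      exact ⟨hmem, hadj.ne⟩
  rw [this, Set.encard_coe_eq_coe_finsetCard]

end General

/-! ## §2 `ℤ^d`: expected number of children `1`, expected degree `2` -/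

variable {d : ℕ}

/-- **The expected number of children is `1`** (`ℤ^d`, `d ≥ 2`): `E #{w : ξ(w, o; T(w))} = 1`, by the mass-transport principle for `f(w, v; U) = 1[U injective ∧ ξ(w, v; T_U(w))]`,
whose out-mass is exactly `1` almost surely (the parent). [cite: LyonsPeres2016, Thm. 11.11 (expected degree 2) and §8.1] -/
theorem lintegral_encard_children_eq_one (hd : 2 ≤ d) (o : Site d) :
    ∫⁻ U, ({w | InfBranch (treeEdges (zdGraph d) U w) w o}.encard : ℝ≥0∞) ∂(labelMeasure (Site d)) = 1 := by
  classical
  haveI : Nonempty (Fin d) := ⟨⟨0, by omega⟩⟩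
  haveI : Infinite (Site d) := Pi.infinite_of_right
  haveI : IsProbabilityMeasure (labelMeasure (Site d)) := isProbabilityMeasure_labelMeasure _
  set G := zdGraph d with hGdef
  set F : Site d → Site d → (Sym2 (Site d) → ℝ) → ℝ≥0∞ := fun w v U =>
    if Function.Injective U ∧ InfBranch (treeEdges G U w) w v then 1 else 0 with hFdef
  have hFmeas : ∀ w v, Measurable (F w v) := fun w v =>
    Measurable.ite (measurableSet_setOf.2 ((measurableSet_setOf.1 measurableSet_injective).and
      (measurableSet_setOf.1 (measurableSet_infBranch_treeEdges (G := G) w w v)))) measurable_const measurable_const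
  have hFinv : ∀ (γ : G ≃g G) (w v : Site d) (U : Sym2 (Site d) → ℝ), F (γ w) (γ v) (actLabels γ U) = F w v U := by
    intro γ w v U
    by_cases hU : Function.Injective U
    · simp only [hFdef, injective_actLabels_iff, infBranch_treeEdges_actLabels_iff γ hU]
    · have hU' : ¬ Function.Injective (actLabels γ U) := by rwa [injective_actLabels_iff]
      simp only [hFdef, hU, hU', false_and, if_false]
  have hMTP := lintegral_tsum_eq_of_isGraphUnimodular G (zdGraph_connected d) (isGraphTransitive_zdGraph d) (isGraphUnimodular_zdGraph d)
      (labelMeasure (Site d)) (fun γ => actLabels γ) (fun γ => measurable_actLabels γ) (fun γ => labelMeasure_map_actLabels γ) hFmeas hFinv o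
  have hout_eq : ∀ U, (∑' v, F o v U) = ({v | Function.Injective U ∧ InfBranch (treeEdges G U o) o v}.encard : ℝ≥0∞) := fun U => tsum_ite_eq_encard _
  have hin_eq : ∀ U, (∑' w, F w o U) = ({w | Function.Injective U ∧ InfBranch (treeEdges G U w) w o}.encard : ℝ≥0∞) := fun U => tsum_ite_eq_encard _
  have hgood := (Literature.Barriers.CriticalPhenomena.ae_injective_labelMeasure (V := Site d)).and (ae_forall_root_existsUnique_ray hd)
  -- out-mass is exactly `1` almost surely
  have hout_one : ∀ᵐ U ∂(labelMeasure (Site d)), (∑' v, F o v U) = 1 := by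
    filter_upwards [hgood] with U hU
    obtain ⟨hUinj, hall⟩ := hU
    obtain ⟨R, hR, hR0, hRadj⟩ := (hall o).2.exists
    rw [hout_eq]
    have : {v | Function.Injective U ∧ InfBranch (treeEdges G U o) o v} = {R 1} := by
      ext v
      rw [Set.mem_setOf_eq, Set.mem_singleton_iff, infBranch_treeEdges_iff_eq_ray_one zdGraph_preconnected_holds (hall o).1 hR hR0 hRadj]
      exact ⟨fun h => h.2, fun h => ⟨hUinj, h⟩⟩
    rw [this, Set.encard_singleton]
    simp
  -- in-mass is the number of children almost surely
  have hin_ae : ∀ᵐ U ∂(labelMeasure (Site d)), (∑' w, F w o U) = ({w | InfBranch (treeEdges G U w) w o}.encard : ℝ≥0∞) := by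
    filter_upwards [hgood] with U hU
    rw [hin_eq]
    congr 2
    ext w
    exact ⟨fun h => h.2, fun h => ⟨hU.1, h⟩⟩
  calc ∫⁻ U, ({w | InfBranch (treeEdges G U w) w o}.encard : ℝ≥0∞) ∂(labelMeasure (Site d))
      = ∫⁻ U, ∑' w, F w o U ∂(labelMeasure (Site d)) := lintegral_congr_ae (hin_ae.mono fun U hU => hU.symm)
    _ = ∫⁻ U, ∑' v, F o v U ∂(labelMeasure (Site d)) := hMTP.symm
    _ = ∫⁻ _, (1 : ℝ≥0∞) ∂(labelMeasure (Site d)) := lintegral_congr_ae hout_one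
    _ = 1 := by simp

/-- **THE WMSF-EXPECTED DEGREE OF EVERY VERTEX OF `ℤ^d` IS `2`** (`d ≥ 2`; Lyons–Peres 2016 Thm. 11.11, first assertion, for `ℤ^d`): `E deg_{𝔉_w(U)}(o) = 2`, the degree being
one parent plus an expected single child. [cite: LyonsPeres2016, Thm. 11.11] -/
theorem lintegral_configDegree_wmsf_eq_two (hd : 2 ≤ d) (o : Site d) :
    ∫⁻ U, (configDegree (zdGraph d) (wmsf (zdGraph d) U) o : ℝ≥0∞) ∂(labelMeasure (Site d)) = 2 := by
  haveI : Nonempty (Fin d) := ⟨⟨0, by omega⟩⟩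
  haveI : Infinite (Site d) := Pi.infinite_of_right
  haveI : IsProbabilityMeasure (labelMeasure (Site d)) := isProbabilityMeasure_labelMeasure _
  have hgood := (Literature.Barriers.CriticalPhenomena.ae_injective_labelMeasure (V := Site d)).and (ae_forall_root_existsUnique_ray hd)
  have hdeg : ∀ᵐ U ∂(labelMeasure (Site d)), (configDegree (zdGraph d) (wmsf (zdGraph d) U) o : ℝ≥0∞) =
      1 + ({w | InfBranch (treeEdges (zdGraph d) U w) w o}.encard : ℝ≥0∞) := by
    filter_upwards [hgood] with U hU
    obtain ⟨hUinj, hall⟩ := hU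
    have h1 : ((configDegree (zdGraph d) (wmsf (zdGraph d) U) o : ℕ∞) : ℝ≥0∞) =
        (({y | (openGraph (wmsf (zdGraph d) U)).Adj o y}.encard : ℕ∞) : ℝ≥0∞) := by rw [configDegree_wmsf_eq]
    have h2 := encard_forestNeighbours_eq zdGraph_preconnected_holds hUinj (fun v => (hall v).1) (fun v => (hall v).2) o
    rw [h2] at h1
    rw [show ((configDegree (zdGraph d) (wmsf (zdGraph d) U) o : ℕ) : ℝ≥0∞) =
      ((configDegree (zdGraph d) (wmsf (zdGraph d) U) o : ℕ∞) : ℝ≥0∞) from (ENat.toENNReal_coe _).symm, h1]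
    simp
  rw [lintegral_congr_ae hdeg, lintegral_add_left measurable_const, lintegral_const, measure_univ, mul_one,
    lintegral_encard_children_eq_one hd o]
  norm_num

/-- `ℤ³`: the WMSF-expected degree of every vertex is `2`. [cite: LyonsPeres2016, Thm. 11.11] -/
theorem lintegral_configDegree_wmsf_eq_two_Z3 (o : Site 3) :
    ∫⁻ U, (configDegree (zdGraph 3) (wmsf (zdGraph 3) U) o : ℝ≥0∞) ∂(labelMeasure (Site 3)) = 2 :=
  lintegral_configDegree_wmsf_eq_two (d := 3) (by norm_num) o

end Summit.CriticalPhenomena.PercolationContinuityZ3.Theorems.Rsw3
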